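import Summits.BirchSwinnertonDyer.BirchSwinnertonDyer.Theorems.KimAtThreeDeepUpperOfPortsDevissage
import Summits.BirchSwinnertonDyer.BirchSwinnertonDyer.Theorems.KimAtThreeKolyvaginIsogenyCruxes
import Literature.NumberTheory.EllipticCurves.SelmerCorankControlRatProofs
import HarnessLib

/-!
# Route `KimAtThreeKolyvagin` (rung W2): the GLUE item `DeepUpperAtThreeOfParts` (stmt-BirchSwinnertonDyer-19563)
# of the §U tenure split of crux `DeepUpperAtThree` (item 19076) — PROVED

Cell `bsd-addord`, seat `bsd-addord-w2-c2` (gen 3), landing the planner's kernel-checked glue (planner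
bsd-addord-plan g15, `HOME/planner/splitW2/EnvW2.lean` / `SketchGlueW2.lean`, rc 0; director-bsd GO
2026-08-26T10:01:17Z; route rev 4–6). ONE theorem, no definition, no named fact, no `sorry`; it closes the
GLUE item 19563 by type-match (`… : …Theses.KimAtThreeKolyvagin.DeepUpperAtThreeOfParts`) and nothing else:
the content children 19560 (`KatoKuriharaPortThreeShared`, the shared-generator PORT″ at `t = 0`, FLAG
K22-Thm3.13-PORT@3), 19561 (`StubAtEmptyLevelThree`) and 19562 (`DeepUpperAtThreeOffKatoStratum`) stay OPEN,
and the four leaves (Sakamoto 2024 Thm 4.4 ×2, Gross–Zagier–Kolyvagin, Poitou–Tate, Carayol) are PUBLISHED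
inputs by name. HONEST FRAMING: BSD is not proved by any of this; a closed glue closes bookkeeping of rung W2
(`closes rung W2 of BirchSwinnertonDyer` only when every child closes), never summit credit.

## Proof (verbatim the planner's EnvW2 proof)

Reduce `DeepUpperAtThree` to lattice-optimal, degree-minimal data at the conductor (kim3 g9,
`KimAtThreeKolyvaginIsogenyCruxes.deepUpperAtThree_of_forall_optimalDatum_atConductor`, Carayol = child L5);
`by_cases` on the Kato stratum `Addv W₀ 3 ∧ 3 ∤ c₃ ∧ #E(ℚ₃)[3] = 1 ∧ 3 ∤ c_{D₀}`: ON it, w2-c3's end-of-ports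
theorem `KimAtThreeDeepUpperOfPortsDevissage.deepUpper_optimal_of_ports_of_towerSurj` with the Poitou–Tate
families produced from the PUB fact (child L4), the place `v₃ ∣ 3` (`Rat.HeightOneSpectrum.primesEquiv`) and
one generator family `η` (`IsCyclic.exists_generator`) constructed here, the port (child C1) and the stub
(child C2) instantiated at them; OFF it, child C3 verbatim.

References: [Sakamoto2024] Thm. 4.4; [MazurRubin2004] Thm. 4.4.1, 5.2.12; [Kim2022StructureSelmer] Thm. 3.13,
Thm. 1.9 (6); [Kim2025RefinedTNC] Thm. 1.1; [Carayol1986]; [MilneADT2006] I Thm. 4.10; planner memo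
`HOME/planner/SPLIT-DRAFTS-W2-g15.md` §U.
-/

-- the Theorems namespace of a single-conjunct summit repeats the summit name by design (D-0017)
set_option linter.dupNamespace false

noncomputable section

namespace Summit.BirchSwinnertonDyer.BirchSwinnertonDyer.Theorems.KimAtThreeDeepUpperSplitGlue

open scoped Classical NumberField
open Function IsDedekindDomain NumberField WeierstrassCurve
  Literature.NumberTheory.EllipticCurves Literature.NumberTheory.EllipticCurves.ModularForms
  Literature.NumberTheory.EllipticCurves.Rank1Residual
  Literature.NumberTheory.GaloisCohomology
  Summit.BirchSwinnertonDyer.Rank1Residual.GaloisImage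
  Summit.BirchSwinnertonDyer.BirchSwinnertonDyer.Theorems
  Summit.BirchSwinnertonDyer.BirchSwinnertonDyer.Theorems.KimAtThreeDeepUpperOfPortsDevissage
  Summit.BirchSwinnertonDyer.BirchSwinnertonDyer.Theorems.KimAtThreeKolyvaginIsogenyCruxes

/-- **Glue item 19563 `DeepUpperAtThreeOfParts`, PROVED**: the seven §U children imply the crux
`DeepUpperAtThree` — `SakamotoKolyvaginThree → RankEqAnalyticRankLeOne → PoitouTateSelmerDuality →
CarayolLevelEqConductor → KatoKuriharaPortThreeShared → StubAtEmptyLevelThree → DeepUpperAtThreeOffKatoStratum →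
DeepUpperAtThree` (planner EnvW2 proof: optimal-datum-at-conductor reduction, then the end-of-ports road on the
Kato stratum / the complement child off it). [cite: Kim2025RefinedTNC, Thm. 1.1] [cite: Sakamoto2024, Thm. 4.4 (p. 926)]
[cite: MazurRubin2004, Thm. 4.4.1 and Thm. 5.2.12] [cite: Carayol1986] -/
theorem deepUpperAtThreeOfParts_proof :
    Summit.BirchSwinnertonDyer.BirchSwinnertonDyer.Theses.KimAtThreeKolyvagin.DeepUpperAtThreeOfParts := by
  intro hSak hGZK hPT hlev hPort hStub hOff
  refine deepUpperAtThree_of_forall_optimalDatum_atConductor hlev ?_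
  intro W₀ _ _ htow hfin N _ hN D₀ hopt hdeg hint hord
  by_cases hroad :
      ((haveI : Fact (Nat.Prime 3) := ⟨Nat.prime_three⟩; Addv W₀ 3) ∧
        ¬ 3 ∣ (W₀.baseChange ℚ_[3]).localTamagawaNumber ℤ_[3] ∧
        Nat.card {Q : (W₀.baseChange ℚ_[3]).toAffine.Point // (3 : ℕ) • Q = 0} = 1 ∧
        ¬ (3 : ℤ) ∣ D₀.maninConstant)
  · obtain ⟨hadd, hc3, ht0, hcD⟩ := hroad
    -- Poitou–Tate families from the PUB fact
    obtain ⟨inv, hperf, hsum, -, hcompl⟩ := hPT 3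
    have hPT' : ∀ k' : ℕ, ∃ inv' : LocalInvariants ℚ (3 ^ (k' + 1)),
        inv'.IsPerfect ∧ inv'.SumLocalTermEqZero ∧ inv'.UnramifiedOrthogonal ∧ inv'.SelmerComplement :=
      fun k' => haveI : NeZero (3 ^ (k' + 1)) := ⟨pow_ne_zero _ three_ne_zero⟩; hPT (3 ^ (k' + 1))
    choose inv' hperf' hsum' _hunr' hcompl' using hPT'
    have hinj' : ∀ k', ∀ v : HeightOneSpectrum (𝓞 ℚ), Injective (inv' k' (Sum.inr v)) :=
      fun k' v => ((hperf' k') v).1.injective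
    -- the place above 3
    let v₃ : HeightOneSpectrum (𝓞 ℚ) := (Rat.HeightOneSpectrum.primesEquiv (R := 𝓞 ℚ)).symm ⟨3, Nat.prime_three⟩
    have hgen3 : Rat.HeightOneSpectrum.natGenerator v₃ = 3 :=
      congrArg Subtype.val ((Rat.HeightOneSpectrum.primesEquiv (R := 𝓞 ℚ)).apply_symm_apply ⟨3, Nat.prime_three⟩)
    have hv₃ : ((3 : ℕ) : 𝓞 ℚ) ∈ v₃.asIdeal := by
      have h := Rat.HeightOneSpectrum.natCast_natGenerator_mem v₃
      rwa [hgen3] at h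
    -- one generator family η
    have hgen : ∀ q : HeightOneSpectrum (𝓞 ℚ), ∃ η : (ZMod (Ideal.absNorm q.asIdeal))ˣ,
        Subgroup.zpowers η = ⊤ := fun q => by
      haveI : Fact (Ideal.absNorm q.asIdeal).Prime := ⟨FSComp.prime_absNorm_rat q⟩
      obtain ⟨g, hg⟩ := IsCyclic.exists_generator (α := (ZMod (Ideal.absNorm q.asIdeal))ˣ)
      exact ⟨g, (Subgroup.eq_top_iff' _).mpr hg⟩
    choose η hη using hgen
    exact deepUpper_optimal_of_ports_of_towerSurj hSak.1 hSak.2 hGZK W₀ hadd hc3 htow ht0 D₀ hopt hcD hint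
      hord inv hperf hsum hcompl inv' hperf' hsum' hcompl' hinj' v₃ hv₃ η hη
      (hPort W₀ htow hadd hc3 ht0 v₃ hv₃ η hη D₀ hN hopt hcD) (hStub W₀ htow η hη)
  · exact hOff W₀ htow hfin hN D₀ hopt hdeg hint hord hroad

end Summit.BirchSwinnertonDyer.BirchSwinnertonDyer.Theorems.KimAtThreeDeepUpperSplitGlue

end
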